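import Summits.BirchSwinnertonDyer.Rank1Residual.F1Sign2.TwistPeriodQuotientProofs
import HarnessLib

/-!
# Cell `bsd-f1-sign2`, AN-33t/u/v PROOFS (§10): on the good-at-`2`, `E[2]`-irreducible part of the slice the period index drops out — KERNEL-CHECKED modulo the named facts `hGV` / a per-curve period datum (-an g16, Sketch_v37 §10)

PORT (cell `bsd-f1-sign2`, seat `-ty` g11) of -an g16's tree-rebased file of record `MEMO-an-data/g16/Sketch_v37.lean` 454eaaa5b944aeb6 (= MEMO-an v1.40 /
`Sketch_v36.lean` 335ae8cb61bfaf5b rebased on the tree: imports `F1Sign2/UnitDoorParityAtTwo` + `F1Sign2/TwistedMinusSymbolSumProofs`, the 37 decls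
byte-identical in the tree deleted, the v32-generalised «units AWAY from M» helpers renamed `…_away`; farm rc 0 · 0 err · 0 warn · 0 sorry,
`bc/Sketch_v37_check.json` 6d9656a1424da834; evidence #60 on stmt-23715).  REF1 §126 (refuter-bsd-f1-sign2-ref1 g11, 2026-08-28T17:18:39Z): «§4–§10 Away
generalisation clean; 29/29 new theorems axioms {propext, Classical.choice, Quot.sound}».  Typer edits = this header, the section ranges, added
docstrings on undocumented helpers; proofs VERBATIM.  Nothing here proves BSD; 23715 not closed.
Section §10 of the port file: AN-33t `…_of_periodUnit` family (per-curve period datum `hw : ∃ w, ‖w‖₂ = 1 ∧ c_∞(W)·|Ω⁻(W)| = w·Ω⁻_f`), the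
`_goodAtTwo` corollaries from the Literature named fact `numRealComponents_mul_imaginaryPeriodRat_eq_unit_mul_minusPeriod_two` (hGV, GV 2000 Rem 3.4 +
Abbes–Ullmo + Edixhoven; `Literature/…/ModularCurveMinusPeriodRatio.lean`), AN-33t″ door-independence, AN-33u `doorUnitValueAt_of_pureCycle_goodAtTwo`,
AN-33v glue.  REF2 v36 §1: per-door bookkeeping KNOWN (Cremona 1997 §2.11; GV 2000 Rem 3.4; Pal 2012 Prop 2.5); door-independence / unit-from-the-bit
sentences NOT IN PRINT verbatim — nearest Kriz–Li 2019 Thm 5.1(2) + L.5.12 + Ex. 6.1, Ono 2001 Thm 3.5; VARIANT; beyond-print no.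
[cite: GreenbergVatsal2000, §3, Remark 3.4] [cite: KrizLi2019, Thm. 5.1, Lemma 5.12, Ex. 6.1] [cite: Pal2012, Prop. 2.5]
-/

set_option autoImplicit false

noncomputable section

open scoped Classical MatrixGroups ModularForm

open CongruenceSubgroup WeierstrassCurve NumberField Literature.NumberTheory.EllipticCurves Literature.NumberTheory.EllipticCurves.ModularForms
  Literature.NumberTheory.EllipticCurves.Rank1Residual
  Literature.NumberTheory.EllipticCurves.Rank1Residual.Typed
  Summit.BirchSwinnertonDyer.Rank1Residual
  Summit.BirchSwinnertonDyer.Rank1Residual.F1Sign2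
  Summit.BirchSwinnertonDyer.Rank1Residual.F1Sign2.TranspositionDoor
  Summit.BirchSwinnertonDyer.BirchSwinnertonDyer.Theorems.RankOneAtTwoOneDoor

namespace Summit.BirchSwinnertonDyer.Rank1Residual.F1Sign2.ANg16

/-! ### §10 AN-33t/u/v (v30): on the good-at-`2`, `E[2]`-irreducible part of the slice the period index drops out

Two tree inputs make the period index `κ/(|u(C)|·c_∞(W))` of AN-33n/o a `2`-adic unit:
* the NAMED FACT `numRealComponents_mul_imaginaryPeriodRat_eq_unit_mul_minusPeriod_two` (Greenberg–Vatsal 2000 §3 Rem. 3.4 + Abbes–Ullmo 1996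
  Thm A + Edixhoven 1991 Prop. 2; file `ModularCurveMinusPeriodRatio`): for `W` globally minimal, good at `2`, `ρ̄_{W,2}` irreducible and `f` its
  newform, `c_∞(W)·|Ω⁻(W)| = w·Ω⁻_f` with `‖w‖₂ = 1` — used as a hypothesis `(hGV : …)`;
* the THEOREM `u_eq_one_or_eq_neg_one_of_smul_quadraticTwist_of_squarefree` (Pal 2012 Prop. 2.5/Cor. 2.6, PROVED in the tree): for `W` globally
  minimal, `d ≡ 1 (4)` square-free with `W` semistable at the primes of `d` (here: `gcd(d, N_W) = 1` ⇒ good), and ANY globally minimal model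
  `Wd = C • W^{(d)}`: `u(C) = ±1`.
Hence (AN-33t) at a unit-class door: `v₂(L(Wd,1)/Ω(Wd)) = v₂(2u/w) = 1 + v₂(u)`, with `u` any minus-symbol unit in whose class `Σ_d ≡ 2u (mod 4u)`;
by AN-33k/AN-33q that class condition holds at every pure `3`-cycle door as soon as `η_f(u) = 1`, and then `F_{q₀} = (2z₀+1)u` forces
`v₂(u) = v₂(F_{q₀})`: **`v₂(L(Wd,1)/Ω(Wd)) = 1 + v₂(F_{q₀}(f))`, door-independent and period-free.** -/

section GoodAtTwo

open scoped NumberTheorySymbols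

open Literature.NumberTheory.QuadraticFields NumberField IsDedekindDomain IsDedekindDomain.HeightOneSpectrum Rat.HeightOneSpectrum

variable {N : ℕ} [NeZero N] {f : CuspForm (Gamma0 N) 2}

/-- `‖w‖₂ = 1` for a rational `w` means `w ≠ 0` and `v₂(w) = 0`. -/
theorem ne_zero_and_padicValRat_eq_zero_of_norm_eq_one {w : ℚ} (hw : ‖(w : ℚ_[2])‖ = 1) :
    w ≠ 0 ∧ padicValRat 2 w = 0 := by
  haveI : Fact (Nat.Prime 2) := ⟨Nat.prime_two⟩
  have hw0 : w ≠ 0 := by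
    rintro rfl
    simp at hw
  refine ⟨hw0, ?_⟩
  rw [Padic.eq_padicNorm, padicNorm.eq_zpow_of_nonzero hw0] at hw
  have h1 : ((2 : ℕ) : ℚ) ^ (-padicValRat 2 w) = 1 := by exact_mod_cast hw
  have h2 := (zpow_eq_one_iff_right₀ (by norm_num : (0 : ℚ) ≤ ((2 : ℕ) : ℚ))
    (by norm_num : ((2 : ℕ) : ℚ) ≠ 1)).mp h1
  omega

/-- `gcd(d, N_W) = 1` ⇒ `W` has good (hence good-or-multiplicative) reduction at every prime of `d` (the semistability input of Pal's
`ũ = 1`), via `hasGoodReductionAtPrime_of_not_dvd_conductorNorm'` and the prime-vs-place bookkeeping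
`hasGoodReductionAtPrime_iff_hasGoodReductionAt_ringOfIntegers`. -/
theorem good_or_mult_at_primes_of_gcd_conductorNorm_eq_one (W : WeierstrassCurve ℚ) [W.IsElliptic] {d : ℤ}
    (hgcd : Int.gcd d (W.conductorNorm ℤ) = 1) :
    ∀ v : HeightOneSpectrum (𝓞 ℚ), ((primesEquiv v : ℕ) : ℤ) ∣ d →
      W.HasGoodReductionAt v ∨ W.HasMultiplicativeReductionAt v := by
  intro v hv
  left
  have hℓ : (primesEquiv v : ℕ).Prime := (primesEquiv v).2
  haveI := Fact.mk hℓ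
  have hdvd : (primesEquiv v : ℕ) ∣ d.natAbs := Int.natCast_dvd.mp hv
  have hnd : ¬ (primesEquiv v : ℕ) ∣ W.conductorNorm ℤ := by
    intro hN
    have h1 : (primesEquiv v : ℕ) ∣ Nat.gcd d.natAbs (W.conductorNorm ℤ) := Nat.dvd_gcd hdvd hN
    have h2 : Int.gcd d (W.conductorNorm ℤ) = Nat.gcd d.natAbs (W.conductorNorm ℤ) := by
      rw [Int.gcd_eq_natAbs, Int.natAbs_natCast]
    rw [← h2, hgcd] at h1
    exact hℓ.one_lt.ne' (Nat.dvd_one.mp h1)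
  have hgood : W.HasGoodReductionAtPrime (primesEquiv v : ℕ) :=
    W.hasGoodReductionAtPrime_of_not_dvd_conductorNorm' hnd
  exact (hasGoodReductionAtPrime_iff_hasGoodReductionAt_ringOfIntegers v W).mp hgood

/-- **AN-33t (PROVED modulo the Greenberg–Vatsal/Abbes–Ullmo named fact): the `2`-adic valuation of `L(Wd,1)/Ω(Wd)` at a unit-class door
is `1 + v₂(u)` — no period index, no model scalar.**  For `W/ℚ` globally minimal with good reduction at `2`, `ρ̄_{W,2}` irreducible, newform `f`
(`IsNewformOf W f`, `hasEntireLFunction_rat`), a door `d < 0`, `d ≡ 1 (4)` square-free with `gcd(d, N_W) = 1`, ANY globally minimal model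
`Wd = C • W^{(d)}`, and a rational `u ≠ 0` with `Σ_d = 2(2w+1)u`: `L(Wd,1)/Ω(Wd) = qd ∈ ℚ` with `v₂(qd) = 1 + v₂(u)`.
Inputs: AN-33o; `hGV` (`c_∞(W)|Ω⁻(W)| = w·Ω⁻_f`, `‖w‖₂ = 1`); Pal's `u(C) = ±1`. -/
theorem exists_rat_value_div_period_of_unitClass_of_periodUnit
    (hE : hasEntireLFunction_rat)
    (W : WeierstrassCurve ℚ) [W.IsElliptic] [W.IsGloballyMinimal] (hfW : IsNewformOf W f)
    (hw : ∃ w : ℚ, ‖(w : ℚ_[2])‖ = 1 ∧ ((W.baseChange ℝ).numRealComponents : ℝ) * W.imaginaryPeriodRat = w * minusPeriod f)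
    {d : ℤ} (hd0 : d < 0) (hsq : Squarefree d) (hd4 : d % 4 = 1) (hgcd : Int.gcd d (W.conductorNorm ℤ) = 1)
    (Wd : WeierstrassCurve ℚ) [Wd.IsGloballyMinimal] (C : VariableChange ℚ) (hC : C • W.quadraticTwist (d : ℚ) = Wd)
    {u : ℚ} (hu0 : u ≠ 0)
    (hS : haveI : NeZero d.natAbs := ⟨Int.natAbs_ne_zero.mpr hsq.ne_zero⟩
      ∃ w : ℤ, ratMinusTwistedSymbolSum f (jacobiChar d.natAbs) = (((2 : ℚ) * (2 * w + 1) * u : ℚ) : ℂ)) :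
    ∃ qd : ℚ, Wd.entireLFunction 1 / (Wd.realPeriodRat : ℂ) = (qd : ℂ) ∧ padicValRat 2 qd = 1 + padicValRat 2 u := by
  haveI : Fact (Nat.Prime 2) := ⟨Nat.prime_two⟩
  -- the Greenberg–Vatsal / Abbes–Ullmo unit `w`
  obtain ⟨w, hw1, hwP⟩ := hw
  obtain ⟨hw0, hvw⟩ := ne_zero_and_padicValRat_eq_zero_of_norm_eq_one hw1
  -- `κ := c_∞(W)/w`
  set n : ℕ := (W.baseChange ℝ).numRealComponents with hndef
  have hnq : (n : ℚ) = if 0 < W.Δ then 2 else 1 := by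
    rw [hndef, numRealComponents_baseChange_real W]; split_ifs <;> simp
  have hκ : minusPeriod f = ((((n : ℚ) / w : ℚ)) : ℝ) * W.imaginaryPeriodRat := by
    have hw0' : (w : ℝ) ≠ 0 := by exact_mod_cast hw0
    push_cast
    rw [div_mul_eq_mul_div, hwP]
    exact (mul_div_cancel_left₀ _ hw0').symm
  obtain ⟨qd, hqd, hv⟩ :=
    exists_rat_value_div_period_of_unitClass hE W hfW hd0 hsq hd4 hgcd Wd C hC hκ hu0 hS
  refine ⟨qd, hqd, ?_⟩
  -- `|u(C)| = 1` (Pal 2012 Prop. 2.5 / Cor. 2.6, tree theorem)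
  have hA : |(C.u : ℚ)| = 1 := by
    rcases W.u_eq_one_or_eq_neg_one_of_smul_quadraticTwist_of_squarefree hd4 hsq
      (good_or_mult_at_primes_of_gcd_conductorNorm_eq_one W hgcd) Wd C hC with h | h <;> simp [h]
  rw [hv, hA, one_mul, ← hnq]
  have hn0 : (n : ℚ) ≠ 0 := by rw [hnq]; split_ifs <;> norm_num
  have hred : 2 * u * ((n : ℚ) / w) / (n : ℚ) = 2 * u / w := by
    field_simp
  have h22 : padicValRat 2 (2 : ℚ) = 1 := by
    have := padicValRat.self (p := 2) one_lt_two
    simpa using this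
  rw [hred, padicValRat.div (mul_ne_zero two_ne_zero hu0) hw0, padicValRat.mul two_ne_zero hu0, hvw, h22]
  omega

/-- (v35) The `2 ∤ N` case via the named fact `hGV` — original statement, now a corollary of `exists_rat_value_div_period_of_unitClass_of_periodUnit`. -/
theorem exists_rat_value_div_period_of_unitClass_goodAtTwo
    (hGV : numRealComponents_mul_imaginaryPeriodRat_eq_unit_mul_minusPeriod_two) (hE : hasEntireLFunction_rat)
    (W : WeierstrassCurve ℚ) [W.IsElliptic] [W.IsGloballyMinimal]
    (h2 : W.HasGoodReductionAtPrime 2) (hirr : W.HasIrreducibleModPGaloisRep 2) (hfW : IsNewformOf W f)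
    {d : ℤ} (hd0 : d < 0) (hsq : Squarefree d) (hd4 : d % 4 = 1) (hgcd : Int.gcd d (W.conductorNorm ℤ) = 1)
    (Wd : WeierstrassCurve ℚ) [Wd.IsGloballyMinimal] (C : VariableChange ℚ) (hC : C • W.quadraticTwist (d : ℚ) = Wd)
    {u : ℚ} (hu0 : u ≠ 0)
    (hS : haveI : NeZero d.natAbs := ⟨Int.natAbs_ne_zero.mpr hsq.ne_zero⟩
      ∃ w : ℤ, ratMinusTwistedSymbolSum f (jacobiChar d.natAbs) = (((2 : ℚ) * (2 * w + 1) * u : ℚ) : ℂ)) :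
    ∃ qd : ℚ, Wd.entireLFunction 1 / (Wd.realPeriodRat : ℂ) = (qd : ℂ) ∧ padicValRat 2 qd = 1 + padicValRat 2 u :=
  exists_rat_value_div_period_of_unitClass_of_periodUnit hE W hfW (hGV W h2 hirr f hfW) hd0 hsq hd4 hgcd Wd C hC hu0 hS

/-- **AN-33t′ (PROVED, lead-facing): the value clause of `hSup` on the good-at-`2` slice from `v₂(u) ≤ t − 1`.** -/
theorem exists_rat_value_div_period_le_of_unitClass_of_periodUnit
    (hE : hasEntireLFunction_rat)
    (W : WeierstrassCurve ℚ) [W.IsElliptic] [W.IsGloballyMinimal] (hfW : IsNewformOf W f)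
    (hw : ∃ w : ℚ, ‖(w : ℚ_[2])‖ = 1 ∧ ((W.baseChange ℝ).numRealComponents : ℝ) * W.imaginaryPeriodRat = w * minusPeriod f)
    {d : ℤ} (hd0 : d < 0) (hsq : Squarefree d) (hd4 : d % 4 = 1) (hgcd : Int.gcd d (W.conductorNorm ℤ) = 1)
    (Wd : WeierstrassCurve ℚ) [Wd.IsGloballyMinimal] (C : VariableChange ℚ) (hC : C • W.quadraticTwist (d : ℚ) = Wd)
    {u : ℚ} (hu0 : u ≠ 0)
    (hS : haveI : NeZero d.natAbs := ⟨Int.natAbs_ne_zero.mpr hsq.ne_zero⟩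
      ∃ w : ℤ, ratMinusTwistedSymbolSum f (jacobiChar d.natAbs) = (((2 : ℚ) * (2 * w + 1) * u : ℚ) : ℂ))
    {t : ℤ} (hle : 1 + padicValRat 2 u ≤ t) :
    ∃ qd : ℚ, Wd.entireLFunction 1 / (Wd.realPeriodRat : ℂ) = (qd : ℂ) ∧ padicValRat 2 qd ≤ t := by
  obtain ⟨qd, hqd, hv⟩ :=
    exists_rat_value_div_period_of_unitClass_of_periodUnit hE W hfW hw hd0 hsq hd4 hgcd Wd C hC hu0 hS
  exact ⟨qd, hqd, hv ▸ hle⟩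

/-- (v35) The `2 ∤ N` case via the named fact `hGV` — original statement, now a corollary of `exists_rat_value_div_period_le_of_unitClass_of_periodUnit`. -/
theorem exists_rat_value_div_period_le_of_unitClass_goodAtTwo
    (hGV : numRealComponents_mul_imaginaryPeriodRat_eq_unit_mul_minusPeriod_two) (hE : hasEntireLFunction_rat)
    (W : WeierstrassCurve ℚ) [W.IsElliptic] [W.IsGloballyMinimal]
    (h2 : W.HasGoodReductionAtPrime 2) (hirr : W.HasIrreducibleModPGaloisRep 2) (hfW : IsNewformOf W f)
    {d : ℤ} (hd0 : d < 0) (hsq : Squarefree d) (hd4 : d % 4 = 1) (hgcd : Int.gcd d (W.conductorNorm ℤ) = 1)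
    (Wd : WeierstrassCurve ℚ) [Wd.IsGloballyMinimal] (C : VariableChange ℚ) (hC : C • W.quadraticTwist (d : ℚ) = Wd)
    {u : ℚ} (hu0 : u ≠ 0)
    (hS : haveI : NeZero d.natAbs := ⟨Int.natAbs_ne_zero.mpr hsq.ne_zero⟩
      ∃ w : ℤ, ratMinusTwistedSymbolSum f (jacobiChar d.natAbs) = (((2 : ℚ) * (2 * w + 1) * u : ℚ) : ℂ))
    {t : ℤ} (hle : 1 + padicValRat 2 u ≤ t) :
    ∃ qd : ℚ, Wd.entireLFunction 1 / (Wd.realPeriodRat : ℂ) = (qd : ℂ) ∧ padicValRat 2 qd ≤ t :=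
  exists_rat_value_div_period_le_of_unitClass_of_periodUnit hE W hfW (hGV W h2 hirr f hfW) hd0 hsq hd4 hgcd Wd C hC hu0 hS hle


/-- **AN-33t″ (PROVED): all-or-nothing across pure doors.**  Under the hypotheses of AN-33t at two doors `d, d'` of the same `W` (same unit
class `u`), the rational quotients `L(Wd,1)/Ω(Wd)` and `L(Wd',1)/Ω(Wd')` have the SAME `2`-adic valuation. -/
theorem padicValRat_value_div_period_eq_of_unitClass_goodAtTwo
    (hGV : numRealComponents_mul_imaginaryPeriodRat_eq_unit_mul_minusPeriod_two) (hE : hasEntireLFunction_rat)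
    (W : WeierstrassCurve ℚ) [W.IsElliptic] [W.IsGloballyMinimal]
    (h2 : W.HasGoodReductionAtPrime 2) (hirr : W.HasIrreducibleModPGaloisRep 2) (hfW : IsNewformOf W f) {u : ℚ} (hu0 : u ≠ 0)
    {d : ℤ} (hd0 : d < 0) (hsq : Squarefree d) (hd4 : d % 4 = 1) (hgcd : Int.gcd d (W.conductorNorm ℤ) = 1)
    (Wd : WeierstrassCurve ℚ) [Wd.IsGloballyMinimal] (C : VariableChange ℚ) (hC : C • W.quadraticTwist (d : ℚ) = Wd)
    (hS : haveI : NeZero d.natAbs := ⟨Int.natAbs_ne_zero.mpr hsq.ne_zero⟩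
      ∃ w : ℤ, ratMinusTwistedSymbolSum f (jacobiChar d.natAbs) = (((2 : ℚ) * (2 * w + 1) * u : ℚ) : ℂ))
    {d' : ℤ} (hd0' : d' < 0) (hsq' : Squarefree d') (hd4' : d' % 4 = 1) (hgcd' : Int.gcd d' (W.conductorNorm ℤ) = 1)
    (Wd' : WeierstrassCurve ℚ) [Wd'.IsGloballyMinimal] (C' : VariableChange ℚ) (hC' : C' • W.quadraticTwist (d' : ℚ) = Wd')
    (hS' : haveI : NeZero d'.natAbs := ⟨Int.natAbs_ne_zero.mpr hsq'.ne_zero⟩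
      ∃ w : ℤ, ratMinusTwistedSymbolSum f (jacobiChar d'.natAbs) = (((2 : ℚ) * (2 * w + 1) * u : ℚ) : ℂ))
    {qd qd' : ℚ} (hq : Wd.entireLFunction 1 / (Wd.realPeriodRat : ℂ) = (qd : ℂ))
    (hq' : Wd'.entireLFunction 1 / (Wd'.realPeriodRat : ℂ) = (qd' : ℂ)) :
    padicValRat 2 qd = padicValRat 2 qd' := by
  obtain ⟨q₁, hq₁, hv₁⟩ :=
    exists_rat_value_div_period_of_unitClass_goodAtTwo hGV hE W h2 hirr hfW hd0 hsq hd4 hgcd Wd C hC hu0 hS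
  obtain ⟨q₂, hq₂, hv₂⟩ :=
    exists_rat_value_div_period_of_unitClass_goodAtTwo hGV hE W h2 hirr hfW hd0' hsq' hd4' hgcd' Wd' C' hC' hu0 hS'
  have e₁ : qd = q₁ := by exact_mod_cast hq.symm.trans hq₁
  have e₂ : qd' = q₂ := by exact_mod_cast hq'.symm.trans hq₂
  rw [e₁, e₂, hv₁, hv₂]

/-- **AN-33u (PROVED, W-level): on the good-at-`2`, `E[2]`-irreducible slice every pure-`3`-cycle door of an `η = 1` curve with `v₂(u) ≤ −1`
is a UNIT DOOR in value currency** — AN-33q with the period-index hypothesis DISCHARGED by `hGV` + Pal.  Conclusion `DoorUnitValueAt W d`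
(both conjuncts: AN-33m non-vanishing and AN-33t′ with `1 + v₂(u) ≤ 0 ≤ t(d) + 2s(d)`). -/
theorem doorUnitValueAt_of_pureCycle_of_periodUnit
    (hE : hasEntireLFunction_rat)
    (W : WeierstrassCurve ℚ) [W.IsElliptic] [W.IsGloballyMinimal] (hfW : IsNewformOf W f)
    (hw : ∃ w : ℚ, ‖(w : ℚ_[2])‖ = 1 ∧ ((W.baseChange ℝ).numRealComponents : ℝ) * W.imaginaryPeriodRat = w * minusPeriod f)
    {u : ℚ} (hu : IsMinusSymbolUnitAway f N u) (hu2 : padicValRat 2 u ≤ -1)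
    {q₀ : ℕ} {a₀ : ℤ} (hq₀ : q₀.Prime) (hq₀o : Odd q₀) (hq₀N : ¬ q₀ ∣ N) (ha₀ : cuspCoeff f q₀ = (a₀ : ℂ)) (ha₀o : Odd a₀)
    (hη : ∃ z₀ : ℤ, minusHalfSum f q₀ = (2 * z₀ + 1) * u)
    (a : ℕ → ℤ) {d : ℤ} (hd0 : d < 0) (hsq : Squarefree d) (hd4 : d % 4 = 1) (hgcd : Int.gcd d (W.conductorNorm ℤ) = 1)
    (hpr : ∀ q ∈ d.natAbs.primeFactors, ¬ q ∣ N ∧ cuspCoeff f q = (a q : ℂ)) (hpure : ∀ q ∈ d.natAbs.primeFactors, Odd (a q))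
    (Wd : WeierstrassCurve ℚ) [Wd.IsElliptic] [Wd.IsGloballyMinimal] (C : VariableChange ℚ) (hC : C • W.quadraticTwist (d : ℚ) = Wd) :
    DoorUnitValueAt W d := by
  refine ⟨entireLFunction_quadraticTwist_one_ne_zero_of_pureCycle_away f hE W hfW hu hq₀ hq₀o hq₀N ha₀ ha₀o hη a hd0 hsq hd4 hgcd hpr hpure, ?_⟩
  set D : ℕ := d.natAbs with hDdef
  haveI : NeZero D := ⟨Int.natAbs_ne_zero.mpr hsq.ne_zero⟩
  have hD3 : D % 4 = 3 := by omega
  have hDsq : Squarefree D := Int.squarefree_natAbs.mpr hsq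
  have hDodd : Odd D := Nat.odd_iff.mpr (by omega)
  have hD1 : 1 < D := by omega
  have hχo : (jacobiChar D).Odd := jacobiChar_neg_one_of_mod_four_eq_three hD3
  have hq : ∀ x : (ZMod D)ˣ, jacobiChar D x = 1 ∨ jacobiChar D x = -1 := by
    intro x
    rcases isQuadratic_jacobiChar (q := D) (x : ZMod D) with h0 | h1 | h2
    · exact absurd ((Units.isUnit x).map (jacobiChar D)) (by rw [h0]; exact not_isUnit_zero)
    · exact Or.inl h1
    · exact Or.inr h2
  obtain ⟨z, hz⟩ := (twistedMinusSymbolSum_unitClassLaw f hfW.1 hfW.coeffField_eq_bot hu hq₀ hq₀o hq₀N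
    ((Nat.Prime.coprime_iff_not_dvd hq₀).mpr hq₀N) ha₀ ha₀o a hDsq hDodd
    (coprime_of_primeFactors_not_dvd (NeZero.ne D) fun q hq' => (hpr q hq').1) hpr (jacobiChar D) hχo hq).1 ⟨hD1, hpure⟩
  obtain ⟨z₀, hz₀⟩ := hη
  have hS : ∃ w : ℤ, ratMinusTwistedSymbolSum f (jacobiChar D) = (((2 : ℚ) * (2 * w + 1) * u : ℚ) : ℂ) := by
    refine ⟨z₀ + z, ?_⟩
    rw [hz, hz₀]; push_cast; ring
  have hle : 1 + padicValRat 2 u ≤ (transpCount W d : ℤ) + 2 * (identCount W d : ℤ) := by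
    have h0 : (0 : ℤ) ≤ (transpCount W d : ℤ) + 2 * (identCount W d : ℤ) := by positivity
    omega
  obtain ⟨qd, hqd, hle'⟩ := exists_rat_value_div_period_le_of_unitClass_of_periodUnit hE W hfW hw hd0 hsq hd4 hgcd Wd C hC
    (ne_of_gt hu.1) hS hle
  exact ⟨Wd, ‹_›, ‹_›, C, qd, hC, hqd, hle'⟩

/-- (v35) The `2 ∤ N` case via the named fact `hGV` — original statement, now a corollary of `doorUnitValueAt_of_pureCycle_of_periodUnit`. -/
theorem doorUnitValueAt_of_pureCycle_goodAtTwo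
    (hGV : numRealComponents_mul_imaginaryPeriodRat_eq_unit_mul_minusPeriod_two) (hE : hasEntireLFunction_rat)
    (W : WeierstrassCurve ℚ) [W.IsElliptic] [W.IsGloballyMinimal]
    (h2 : W.HasGoodReductionAtPrime 2) (hirr : W.HasIrreducibleModPGaloisRep 2) (hfW : IsNewformOf W f)
    {u : ℚ} (hu : IsMinusSymbolUnitAway f N u) (hu2 : padicValRat 2 u ≤ -1)
    {q₀ : ℕ} {a₀ : ℤ} (hq₀ : q₀.Prime) (hq₀o : Odd q₀) (hq₀N : ¬ q₀ ∣ N) (ha₀ : cuspCoeff f q₀ = (a₀ : ℂ)) (ha₀o : Odd a₀)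
    (hη : ∃ z₀ : ℤ, minusHalfSum f q₀ = (2 * z₀ + 1) * u)
    (a : ℕ → ℤ) {d : ℤ} (hd0 : d < 0) (hsq : Squarefree d) (hd4 : d % 4 = 1) (hgcd : Int.gcd d (W.conductorNorm ℤ) = 1)
    (hpr : ∀ q ∈ d.natAbs.primeFactors, ¬ q ∣ N ∧ cuspCoeff f q = (a q : ℂ)) (hpure : ∀ q ∈ d.natAbs.primeFactors, Odd (a q))
    (Wd : WeierstrassCurve ℚ) [Wd.IsElliptic] [Wd.IsGloballyMinimal] (C : VariableChange ℚ) (hC : C • W.quadraticTwist (d : ℚ) = Wd) :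
    DoorUnitValueAt W d :=
  doorUnitValueAt_of_pureCycle_of_periodUnit hE W hfW (hGV W h2 hirr f hfW) hu hu2 hq₀ hq₀o hq₀N ha₀ ha₀o hη a hd0 hsq hd4 hgcd hpr hpure Wd C hC

/-- **AN-33v (PROVED glue): `EggHalfOddSymbolLawAtTwo` + the Greenberg–Vatsal/Abbes–Ullmo fact + modularity ⇒ every admissible pure-`3`-cycle
door of an egg-class slice curve with good reduction at `2` is a unit door** (newform at level `N_W`, any globally minimal model of the twist).
Hence `hSup` on the egg ∧ good-at-`2` sub-slice ⟸ AN-33p′ + `hGV` + ONE door-admissible pure-`3`-cycle `d_K` per curve. -/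
theorem doorUnitValueAt_of_eggHalfOddSymbolLaw (hP : EggHalfOddSymbolLawAtTwo)
    (hGV : numRealComponents_mul_imaginaryPeriodRat_eq_unit_mul_minusPeriod_two) (hE : hasEntireLFunction_rat)
    (W : WeierstrassCurve ℚ) [W.IsElliptic] [W.IsGloballyMinimal] [NeZero (W.conductorNorm ℤ)]
    (hCM : ¬ W.HasCM) (hsurj : ∀ n : ℕ, W.HasSurjectiveModNGaloisRep ((2 ^ n : ℕ) : ℤ)) (htor : Odd W.torsionOrder)
    (htam : Odd W.tamagawaProduct) (hrk : W.analyticRank = 1) (hΔ : 0 < W.Δ) (hegg : MeetsEgg W) (hSha : ShaTwoTrivial W) (h2 : W.HasGoodReductionAtPrime 2)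
    (g : CuspForm (Gamma0 (W.conductorNorm ℤ)) 2) (hgW : IsNewformOf W g)
    {d : ℤ} (hd0 : d < 0) (hsq : Squarefree d) (hd4 : d % 4 = 1) (hgcd : Int.gcd d (W.conductorNorm ℤ) = 1)
    (hpure : ∀ q ∈ d.natAbs.primeFactors, Odd (W.LFunction q))
    (Wd : WeierstrassCurve ℚ) [Wd.IsElliptic] [Wd.IsGloballyMinimal] (C : VariableChange ℚ) (hC : C • W.quadraticTwist (d : ℚ) = Wd) :
    DoorUnitValueAt W d := by
  obtain ⟨u, hu, hu2, q₀, a₀, z₀, hq₀, hq₀o, hq₀N, ha₀, ha₀o, hz₀⟩ :=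
    hP W hCM hsurj htor htam hrk hΔ hegg hSha h2 (W.conductorNorm ℤ) g hgW
  -- `ρ̄_{W,2}` irreducible from surjectivity mod `2`
  haveI : NeZero ((2 : ℕ) : ℚ) := ⟨by norm_num⟩
  have hirr : W.HasIrreducibleModPGaloisRep 2 :=
    hasIrreducibleModPGaloisRep_of_hasSurjectiveModNGaloisRep W 2 (by simpa using hsurj 1)
  -- prime factors of `d` do not divide the level `N_W`
  have hpr : ∀ q ∈ d.natAbs.primeFactors, ¬ q ∣ W.conductorNorm ℤ ∧ cuspCoeff g q = ((W.LFunction q : ℤ) : ℂ) := by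
    intro q hq
    have hqp : q.Prime := Nat.prime_of_mem_primeFactors hq
    have hqd : q ∣ d.natAbs := Nat.dvd_of_mem_primeFactors hq
    refine ⟨fun hqN => ?_, hgW.2 q⟩
    have h1 : q ∣ Int.gcd d (W.conductorNorm ℤ) := by
      rw [Int.gcd_eq_natAbs]
      exact Nat.dvd_gcd hqd (by simpa using hqN)
    rw [hgcd] at h1
    exact hqp.one_lt.ne' (Nat.dvd_one.mp h1)
  exact doorUnitValueAt_of_pureCycle_goodAtTwo hGV hE W h2 hirr hgW (hu.away _) hu2 hq₀ hq₀o hq₀N ha₀ ha₀o ⟨z₀, hz₀⟩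
    (fun q => W.LFunction q)
    hd0 hsq hd4 hgcd hpr hpure Wd C hC

end GoodAtTwo

end Summit.BirchSwinnertonDyer.Rank1Residual.F1Sign2.ANg16
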